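import Literature.RingTheory.HilbertSamuel.ProjDirectrixPlaneChart
import HarnessLib

/-!
# Every `e(A) = t`: on a blow-up chart, the ring of `ℙ(Dir(A))` is a polynomial ring in `t − 1` variables over the
# residue field — `D/𝔑 ≅ k[T_1, …, T_{t−1}]` (CJS 2020, Def. 6.34 (i) / p. 103 L16: «`C_1 = ℙ(Dir_x(X)) ≅ ℙ^{t−1}_{k(x)}`»)

Topic: `Literature/RingTheory/HilbertSamuel`. The general-`t` form of `ProjDirectrixPlaneChart.lean` (`t = 2`, `D/𝔑 ≅ k[T]`)
and `ProjDirectrixLine.lean` (`t = 1`): the ring-level core of «`ℙ(Dir_x(X)) ≅ ℙ^{t−1}_{k(x)}`» (CJS LNM 2270, p. 103 L16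
«We note `C_1 ≃ ℙ^{t−1}_k`, where `t = e^O_x(X)`», Def. 6.34 (i) «`C_1 = ℙ(Dir^O_x(X)) ≅ ℙ^{t−1}_{k(x)}` (`t = e^O_x(X)`)»),
answering the `-- TODO(general form)` of `Literature/AlgebraicGeometry/CossartJannsenSaito2020/NearPointProjDirectrix.lean`
and `…/ProjDirProjectiveLine.lean` at the level of ONE CHART. SETTING (the abstract chart of `ProjDirectrixPlaneChart.lean`):
`R` a ring with a maximal ideal `𝔭 = (c_1, …, c_r)`, `A = R_𝔭` (local, residue field `k`), minimal generators `x` of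
`𝔪 = 𝔭A` with expansions `c_l = Σ_i a_{li} x_i` and symbols `s_l = Σ_i ā_{li} X_i`, `𝒯 = 𝒯(J_x)` the directrix space of
linear forms, and chart data `(D, ψ : R → D, e_1, …, e_r)` with `ψ(c_l) = ψ(c_{j₀}) e_l`, `e_{j₀} = 1`, every element of
`D` a value `F(e)` of a form, `ψ(F(c)) = ψ(c_{j₀})^m F(e)` for forms of degree `m`, and `ψ(z) = 0 ⇒ c_{j₀}^K z = 0` (the
Rees chart `R[𝔭t]_{(c_{j₀} t)}`). Instead of the adapted PAIR of the `t = 2` file we take an ADAPTED FAMILY: an index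
`j₀` (the chart) and indices `j_1, …, j_q` such that the symbols `s_{j₀}, s_{j_1}, …, s_{j_q}` form a basis of
`S_1/𝒯` — typed as the two hypotheses

* (span) every linear form is `L ≡ α₀ s_{j₀} + Σ_m α_m s_{j_m} (mod 𝒯)`,
* (indep) `α₀ s_{j₀} + Σ_m α_m s_{j_m} ∈ 𝒯 ⇒ α₀ = 0 ∧ α = 0`,

so that `t = e(A) = q + 1` (their existence for `e(A) = q + 1` among any generators `c` of `𝔪` is linear algebra, the
`q + 1` analogue of `exists_pair_symbols_compl_directrixSpace`; this file does not need `directrixDim`). With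
`𝔑 = 𝔭D + (Σ_l λ_l e_l : Σ_l λ̄_l s_l ∈ 𝒯) ⊆ D` the ideal of `ℙ(Dir) ∩ Spec D` (`mem_projDirectrixFibre_chart_iff`), PROVED:

* `exists_spaceMap` — `ρ : k[X] → k[T_1, …, T_q]`, `X_i ↦ α₀(i) + Σ_m α_m(i) T_m` where
  `X_i ≡ α₀(i) s_{j₀} + Σ_m α_m(i) s_{j_m} (mod 𝒯)`: a `k`-algebra map KILLING `𝒯·k[X]` with `ρ(s_{j₀}) = 1`,
  `ρ(s_{j_m}) = T_m` (restriction to `ℙ(Dir) ≅ ℙ^q` in the affine coordinates `T_m = s_{j_m}/s_{j₀}`);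
* `coeff_mem_of_eval₂_comp_mem_chartIdeal` (INJECTIVITY) — if `p(e_{j_1}, …, e_{j_q}) ∈ 𝔑` for `p ∈ R[T_1, …, T_q]` then
  every coefficient of `p` lies in `𝔭` (homogenise `p` with `Y_{j₀}`, compare symbols through
  `exists_form_symbolHom_mem_of_mem_chartIdeal` / `symbolHom_sub_mem_of_eval₂_eq` of the `t = 2` file, apply `ρ`);
* `exists_mvPolynomial_sub_eval₂_mem_chartIdeal` (SURJECTIVITY) — every element of `D` is
  `≡ p(e_{j_1}, …, e_{j_q}) (mod 𝔑)` (each ratio `e_l ≡ ψ(α₀) + Σ_m ψ(α_m) e_{j_m}`);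
* **`exists_ringEquiv_mvPolynomial_quotient_chartIdeal`** — `k[T_1, …, T_q] ≅ D/𝔑` with `T_m ↦ e_{j_m}` and `r̄ ↦ ψ(r)`:
  the ring of `ℙ(Dir(A))` on the chart `c_{j₀} ≠ 0` is the polynomial ring in the `q = t − 1` ratios `c_{j_m}/c_{j₀}`
  over `k = R/𝔭` — the standard affine piece `𝔸^{t−1}_k` of `ℙ^{t−1}_k`.

Everything here is PROVED; no definitions and no named facts. NOT a statement of H. Hironaka's manuscript. AI-written
(res-type-031); weaker than expert review.

## References

* V. Cossart, U. Jannsen, S. Saito, *Desingularization: Invariants and Strategy*, LNM 2270 (2020), Lemma 2.7,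
  Def. 2.18, Def. 6.34 (i), p. 103 L16. [CossartJannsenSaito2020]
* The Stacks Project, Tag 0804 (charts of a blowing up). [StacksProject]
-/

noncomputable section

open IsLocalRing MvPolynomial Module
open Literature.AlgebraicGeometry.Resolution Literature.RingTheory.MvPolynomial

namespace Literature.RingTheory.HilbertSamuel

universe u v w

/-! ## Linear forms: coefficients and sums (private copies) -/

section LinearForms

variable {k : Type v} [Field k] {e : ℕ}

/-- The `X_i`-coefficient of `Σ v_j X_j` is `v_i`. [folklore] -/
private theorem coeff_single_linForm₅ (v : Fin e → k) (i : Fin e) :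
    MvPolynomial.coeff (Finsupp.single i 1) (linForm v) = v i := by
  classical
  rw [linForm_apply, MvPolynomial.coeff_sum]
  simp_rw [MvPolynomial.coeff_smul, MvPolynomial.coeff_X, smul_eq_mul]
  rw [Finset.sum_eq_single i]
  · simp
  · intro j _ hj
    rw [if_neg, mul_zero]
    exact fun h => hj (Finsupp.single_left_injective one_ne_zero h)
  · exact fun h => absurd (Finset.mem_univ i) h

/-- A form of degree `1` is the linear form of its `X_i`-coefficients. [folklore] -/
private theorem eq_linForm_coeff₅ {L : MvPolynomial (Fin e) k} (hL : L ∈ homogeneousSubmodule (Fin e) k 1) :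
    L = linForm fun i => MvPolynomial.coeff (Finsupp.single i 1) L := by
  have hL' : L ∈ LinearMap.range (linForm (K := k) (n := e)) := by rwa [range_linForm]
  obtain ⟨v, rfl⟩ := hL'
  congr 1
  funext i
  rw [coeff_single_linForm₅]

/-- `linForm v = Σ_i C(v_i) X_i`. [folklore] -/
private theorem linForm_eq_sum_C_mul₅ (v : Fin e → k) :
    linForm v = ∑ i, C (v i) * (X i : MvPolynomial (Fin e) k) := by
  rw [linForm_apply]
  exact Finset.sum_congr rfl fun i _ => by rw [smul_eq_C_mul]

end LinearForms

/-! ## The space map `ρ : k[X] → k[T_1, …, T_q]` killing the directrix forms -/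

section SpaceMap

variable {A : Type u} [CommRing A] [IsLocalRing A] {n : ℕ} {x : Fin n → A}
  (hx : Ideal.span (Set.range x) = maximalIdeal A) {r : ℕ} (a : Fin r → Fin n → A) {q : ℕ} (j₀ : Fin r)
  (j : Fin q → Fin r)
  (hspan : ∀ L ∈ homogeneousSubmodule (Fin n) (ResidueField A) 1, ∃ (α₀ : ResidueField A) (α : Fin q → ResidueField A),
    L - α₀ • linForm (fun i => residue A (a j₀ i)) - ∑ m, α m • linForm (fun i => residue A (a (j m) i)) ∈
      directrixSpace (tangentConeIdeal x hx))
  (hindep : ∀ (α₀ : ResidueField A) (α : Fin q → ResidueField A),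
    α₀ • linForm (fun i => residue A (a j₀ i)) + ∑ m, α m • linForm (fun i => residue A (a (j m) i)) ∈
      directrixSpace (tangentConeIdeal x hx) → α₀ = 0 ∧ α = 0)

include hspan hindep in
/-- **The space map** `ρ : k[X_1, …, X_n] → k[T_1, …, T_q]`, `X_i ↦ α₀(i) + Σ_m α_m(i) T_m`, where
`X_i ≡ α₀(i) s_{j₀} + Σ_m α_m(i) s_{j_m} (mod 𝒯)` are the coordinates of `X_i` in `S_1 = 𝒯 ⊕ k s_{j₀} ⊕ ⨁_m k s_{j_m}`:
restriction of functions on `ℙ(T(A))` to `ℙ(Dir(A)) ≅ ℙ^q` in the affine coordinates `T_m = s_{j_m}/s_{j₀}`. It KILLS the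
directrix forms (hence `𝒯·k[X]`) and sends `s_{j₀} ↦ 1`, `s_{j_m} ↦ T_m`; more generally `ρ(L) = β₀ + Σ_m β_m T_m` whenever
`L ≡ β₀ s_{j₀} + Σ_m β_m s_{j_m} (mod 𝒯)` (uniqueness of the coordinates). The `q = 1` case is `exists_lineMap`.
[cite: CossartJannsenSaito2020, Def. 2.18, Def. 6.34 (i)] -/
theorem exists_spaceMap :
    ∃ ρ : MvPolynomial (Fin n) (ResidueField A) →ₐ[ResidueField A] MvPolynomial (Fin q) (ResidueField A),
      (∀ f ∈ Ideal.span (directrixSpace (tangentConeIdeal x hx) : Set (MvPolynomial (Fin n) (ResidueField A))),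
        ρ f = 0) ∧
      ρ (linForm fun i => residue A (a j₀ i)) = 1 ∧ ∀ m, ρ (linForm fun i => residue A (a (j m) i)) = X m := by
  classical
  set T := directrixSpace (tangentConeIdeal x hx) with hT
  set s₀ := linForm (fun i => residue A (a j₀ i)) with hs₀
  set s : Fin q → MvPolynomial (Fin n) (ResidueField A) := fun m => linForm (fun i => residue A (a (j m) i)) with hs
  -- the coordinates of the variables
  have hcoord := fun i : Fin n => hspan _ (isHomogeneous_X (ResidueField A) i)
  choose αv βv hXi using hcoord
  let ρ : MvPolynomial (Fin n) (ResidueField A) →ₐ[ResidueField A] MvPolynomial (Fin q) (ResidueField A) :=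
    MvPolynomial.aeval fun i => C (αv i) + ∑ m, C (βv i m) * X m
  have hρX : ∀ i, ρ (X i) = C (αv i) + ∑ m, C (βv i m) * X m := fun i => by simp only [ρ, MvPolynomial.aeval_X]
  -- `ρ(L) = β₀ + Σ β_m T_m` whenever `L ≡ β₀ s₀ + Σ β_m s_m (mod T)`
  have key : ∀ {L : MvPolynomial (Fin n) (ResidueField A)}, L ∈ homogeneousSubmodule (Fin n) (ResidueField A) 1 →
      ∀ {β₀ : ResidueField A} {β : Fin q → ResidueField A}, L - β₀ • s₀ - ∑ m, β m • s m ∈ T →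
        ρ L = C β₀ + ∑ m, C (β m) * X m := by
    intro L hL β₀ β h
    -- write `L = Σ ℓ_i X_i`
    set ℓ : Fin n → ResidueField A := fun i => MvPolynomial.coeff (Finsupp.single i 1) L with hℓ
    have hLsum : L = ∑ i, C (ℓ i) * X i := by
      conv_lhs => rw [eq_linForm_coeff₅ hL]
      exact linForm_eq_sum_C_mul₅ ℓ
    have hρL : ρ L = C (∑ i, ℓ i * αv i) + ∑ m, C (∑ i, ℓ i * βv i m) * X m := by
      rw [hLsum, map_sum]
      simp_rw [map_mul, MvPolynomial.algHom_C, MvPolynomial.algebraMap_eq, hρX]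
      simp_rw [mul_add, Finset.mul_sum, Finset.sum_add_distrib, map_sum, Finset.sum_mul]
      congr 1
      · exact Finset.sum_congr rfl fun i _ => by rw [map_mul]
      · rw [Finset.sum_comm]
        exact Finset.sum_congr rfl fun m _ => Finset.sum_congr rfl fun i _ => by rw [map_mul]; ring
    have hmemT : L - (∑ i, ℓ i * αv i) • s₀ - ∑ m, (∑ i, ℓ i * βv i m) • s m ∈ T := by
      have hdec : L - (∑ i, ℓ i * αv i) • s₀ - ∑ m, (∑ i, ℓ i * βv i m) • s m =
          ∑ i, ℓ i • ((X i : MvPolynomial (Fin n) (ResidueField A)) - αv i • s₀ - ∑ m, βv i m • s m) := by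
        conv_lhs => rw [hLsum]
        simp_rw [smul_sub, Finset.smul_sum, Finset.sum_sub_distrib, Finset.sum_smul, smul_smul, smul_eq_C_mul]
        rw [Finset.sum_comm]
      rw [hdec]
      exact T.sum_mem fun i _ => T.smul_mem _ (hXi i)
    have hdiff : ((∑ i, ℓ i * αv i) - β₀) • s₀ + ∑ m, ((∑ i, ℓ i * βv i m) - β m) • s m ∈ T := by
      have : ((∑ i, ℓ i * αv i) - β₀) • s₀ + ∑ m, ((∑ i, ℓ i * βv i m) - β m) • s m =
          (L - β₀ • s₀ - ∑ m, β m • s m) - (L - (∑ i, ℓ i * αv i) • s₀ - ∑ m, (∑ i, ℓ i * βv i m) • s m) := by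
        simp only [sub_smul, Finset.sum_sub_distrib]; abel
      rw [this]
      exact T.sub_mem h hmemT
    obtain ⟨h1, h2⟩ := hindep _ _ hdiff
    rw [sub_eq_zero] at h1
    have h2' : ∀ m, ∑ i, ℓ i * βv i m = β m := fun m => by
      have := congrFun h2 m
      rwa [Pi.zero_apply, sub_eq_zero] at this
    rw [hρL, h1]
    simp_rw [h2']
  have hs₀S : s₀ ∈ homogeneousSubmodule (Fin n) (ResidueField A) 1 := by
    rw [hs₀, ← range_linForm]; exact LinearMap.mem_range_self _ _
  have hsS : ∀ m, s m ∈ homogeneousSubmodule (Fin n) (ResidueField A) 1 := fun m => by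
    simp only [hs]; rw [← range_linForm]; exact LinearMap.mem_range_self _ _
  refine ⟨ρ, ?_, ?_, ?_⟩
  · -- `ρ` kills `T`, hence `T · k[X]`
    have hle : Ideal.span (T : Set (MvPolynomial (Fin n) (ResidueField A))) ≤ RingHom.ker ρ.toRingHom := by
      rw [Ideal.span_le]
      intro L hL
      have h := key (directrixSpace_le_one _ hL) (β₀ := 0) (β := 0)
        (by simpa only [zero_smul, Pi.zero_apply, Finset.sum_const_zero, sub_zero, SetLike.mem_coe] using hL)
      rw [SetLike.mem_coe, RingHom.mem_ker]
      change ρ L = 0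
      rw [h, map_zero, zero_add]
      exact Finset.sum_eq_zero fun m _ => by rw [Pi.zero_apply, map_zero, zero_mul]
    exact fun f hf => hle hf
  · have h := key hs₀S (β₀ := 1) (β := 0) (by
      simp only [one_smul, Pi.zero_apply, zero_smul, Finset.sum_const_zero, sub_self]
      exact T.zero_mem)
    rw [h, map_one, add_eq_left]
    exact Finset.sum_eq_zero fun m _ => by rw [Pi.zero_apply, map_zero, zero_mul]
  · intro m
    have h := key (hsS m) (β₀ := 0) (β := Pi.single m 1) (by
      rw [zero_smul, sub_zero]
      have : ∑ m', (Pi.single m (1 : ResidueField A) : Fin q → ResidueField A) m' • s m' = s m := by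
        rw [Finset.sum_eq_single m]
        · rw [Pi.single_eq_same, one_smul]
        · intro m' _ hm'
          rw [Pi.single_eq_of_ne hm', zero_smul]
        · exact fun h => absurd (Finset.mem_univ m) h
      rw [this, sub_self]
      exact T.zero_mem)
    rw [h, map_zero, zero_add, Finset.sum_eq_single m]
    · rw [Pi.single_eq_same, map_one, one_mul]
    · intro m' _ hm'
      rw [Pi.single_eq_of_ne hm', map_zero, zero_mul]
    · exact fun h' => absurd (Finset.mem_univ m) h'

end SpaceMap

/-! ## The abstract chart: the structure of `D/𝔑` for every `t = q + 1` -/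

section Chart

variable {R : Type u} [CommRing R] (𝔭 : Ideal R) [𝔭.IsMaximal]
  (A : Type u) [CommRing A] [IsLocalRing A] [Algebra R A] [IsLocalization.AtPrime A 𝔭]
  {n : ℕ} {x : Fin n → A} (hx : Ideal.span (Set.range x) = maximalIdeal A)
  {r : ℕ} {c : Fin r → R}
  (a : Fin r → Fin n → A) (ha : ∀ l, ∑ i, a l i * x i = algebraMap R A (c l))
  {D : Type v} [CommRing D] (ψ : R →+* D) (e : Fin r → D) {q : ℕ} (j₀ : Fin r) (j : Fin q → Fin r)
  (hce : ∀ l, ψ (c l) = ψ (c j₀) * e l) (hej : e j₀ = 1)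
  (hF1 : ∀ d : D, ∃ (m : ℕ) (F : MvPolynomial (Fin r) R), F.IsHomogeneous m ∧ MvPolynomial.eval₂Hom ψ e F = d)
  (hF2 : ∀ (m : ℕ) (F : MvPolynomial (Fin r) R), F.IsHomogeneous m →
    ψ (MvPolynomial.eval c F) = ψ (c j₀) ^ m * MvPolynomial.eval₂Hom ψ e F)
  (hF3 : ∀ z : R, ψ z = 0 → ∃ K : ℕ, c j₀ ^ K * z = 0)
  (hspan : ∀ L ∈ homogeneousSubmodule (Fin n) (ResidueField A) 1, ∃ (α₀ : ResidueField A) (α : Fin q → ResidueField A),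
    L - α₀ • linForm (fun i => residue A (a j₀ i)) - ∑ m, α m • linForm (fun i => residue A (a (j m) i)) ∈
      directrixSpace (tangentConeIdeal x hx))
  (hindep : ∀ (α₀ : ResidueField A) (α : Fin q → ResidueField A),
    α₀ • linForm (fun i => residue A (a j₀ i)) + ∑ m, α m • linForm (fun i => residue A (a (j m) i)) ∈
      directrixSpace (tangentConeIdeal x hx) → α₀ = 0 ∧ α = 0)

include hej in
/-- Padding a form by `Y_{j₀}` does not change its value on the chart (`e_{j₀} = 1`). [folklore] -/
private theorem eval₂Hom_X_pow_mul₅ (K : ℕ) (F : MvPolynomial (Fin r) R) :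
    MvPolynomial.eval₂Hom ψ e (X j₀ ^ K * F) = MvPolynomial.eval₂Hom ψ e F := by
  rw [map_mul, map_pow, MvPolynomial.eval₂Hom_X', hej, one_pow, one_mul]

omit [𝔭.IsMaximal] [IsLocalization.AtPrime A 𝔭] in
/-- Residues of elements of `R` exhaust the residue field of `A = R_𝔭` (`𝔭` maximal). [folklore] -/
private theorem exists_residue_algebraMap_eq₅ [𝔭.IsMaximal] [IsLocalization.AtPrime A 𝔭] (q' : ResidueField A) :
    ∃ ρ : R, residue A (algebraMap R A ρ) = q' := by
  have h𝔭max : 𝔭.IsMaximal := ‹_›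
  obtain ⟨a₀, rfl⟩ := Ideal.Quotient.mk_surjective q'
  obtain ⟨⟨ρ, s⟩, hρs⟩ := IsLocalization.surj 𝔭.primeCompl a₀
  obtain ⟨y, i, hi, hyi⟩ := h𝔭max.exists_inv s.2
  refine ⟨y * ρ, ?_⟩
  change residue A _ = residue A a₀
  rw [← sub_eq_zero, ← map_sub, residue_eq_zero_iff]
  have hs : a₀ * algebraMap R A s = algebraMap R A ρ := hρs
  have h1 : algebraMap R A (y * ρ) - a₀ = -(algebraMap R A i * a₀) +
      (algebraMap R A y * algebraMap R A s + algebraMap R A i - 1) * a₀ := by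
    rw [map_mul]
    linear_combination (-(algebraMap R A y)) * hs
  have h2 : algebraMap R A y * algebraMap R A s + algebraMap R A i - 1 = 0 := by
    rw [← map_mul, ← map_add, hyi, map_one, sub_self]
  rw [h1, h2, zero_mul, add_zero]
  exact Submodule.neg_mem _ (Ideal.mul_mem_right _ _
    ((IsLocalization.AtPrime.to_map_mem_maximal_iff A 𝔭 i).mpr hi))

omit [𝔭.IsMaximal] [IsLocalization.AtPrime A 𝔭] in
/-- `Φ(Y_l) = s_l` for the symbol map. [folklore] -/
private theorem chartSymbolMap_X₅ (l : Fin r) :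
    (MvPolynomial.eval₂Hom (MvPolynomial.C.comp ((residue A).comp (algebraMap R A)))
          (fun l => linForm fun i => residue A (a l i))) (X l : MvPolynomial (Fin r) R) =
      linForm fun i => residue A (a l i) := by
  simp

omit [𝔭.IsMaximal] [IsLocalization.AtPrime A 𝔭] in
/-- `Φ(r) = r̄` for the symbol map. [folklore] -/
private theorem chartSymbolMap_C₅ (ρ : R) :
    (MvPolynomial.eval₂Hom (MvPolynomial.C.comp ((residue A).comp (algebraMap R A)))
          (fun l => linForm fun i => residue A (a l i))) (C ρ : MvPolynomial (Fin r) R) =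
      C (residue A (algebraMap R A ρ)) := by
  simp

include hx ha hej hF1 hF2 hF3 hspan hindep in
/-- **Injectivity of `k[T_1, …, T_q] → D/𝔑`**: if `p(e_{j_1}, …, e_{j_q}) ∈ 𝔑` for a polynomial `p ∈ R[T_1, …, T_q]`, then
every coefficient of `p` lies in `𝔭`. The homogenised form `F_p = Σ_μ p_μ Y_j^μ Y_{j₀}^{M−|μ|}` has the same value on the
chart as a form with symbol in `𝒯·k[X]` (`exists_form_symbolHom_mem_of_mem_chartIdeal`), so
`s_{j₀}^• Φ(F_p) ∈ J_x + 𝒯·k[X] = 𝒯·k[X]` (`symbolHom_sub_mem_of_eval₂_eq`, `tangentConeIdeal_le_span_directrixSpace`); the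
space map `ρ` kills `𝒯·k[X]` and sends `s_{j₀} ↦ 1`, `s_{j_m} ↦ T_m`, so `Σ_μ p̄_μ T^μ = 0`. The `q = 1` case is
`coeff_mem_of_eval₂_mem_chartIdeal`. [cite: CossartJannsenSaito2020, Def. 6.34 (i), p. 103 L16] -/
theorem coeff_mem_of_eval₂_comp_mem_chartIdeal {p : MvPolynomial (Fin q) R}
    (hp : MvPolynomial.eval₂ ψ (fun m => e (j m)) p ∈ (𝔭.map ψ ⊔ Ideal.span {d : D | ∃ lam : Fin r → R,
          (linForm fun i => ∑ l, residue A (algebraMap R A (lam l)) * residue A (a l i)) ∈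
            directrixSpace (tangentConeIdeal x hx) ∧ d = ∑ l, ψ (lam l) * e l})) (μ : Fin q →₀ ℕ) :
    p.coeff μ ∈ 𝔭 := by
  classical
  set s₀ := linForm (fun i => residue A (a j₀ i)) with hs₀
  set s : Fin q → MvPolynomial (Fin n) (ResidueField A) := fun m => linForm (fun i => residue A (a (j m) i)) with hs
  set 𝔗 := Ideal.span (directrixSpace (tangentConeIdeal x hx) : Set (MvPolynomial (Fin n) (ResidueField A))) with h𝔗
  set M := p.totalDegree with hM
  -- the homogenised form `F_p`
  set Fp : MvPolynomial (Fin r) R := ∑ ν ∈ p.support,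
    C (p.coeff ν) * ((∏ m ∈ ν.support, X (j m) ^ ν m) * X j₀ ^ (M - ν.sum fun _ k => k)) with hFp
  have hFphom : Fp.IsHomogeneous M := by
    refine IsHomogeneous.sum _ _ _ fun ν hν => ?_
    have hν' : (ν.sum fun _ k => k) ≤ M := MvPolynomial.le_totalDegree hν
    have hprod : (∏ m ∈ ν.support, (X (j m) : MvPolynomial (Fin r) R) ^ ν m).IsHomogeneous
        (∑ m ∈ ν.support, ν m) :=
      IsHomogeneous.prod _ _ _ fun m _ => isHomogeneous_X_pow _ _
    have h := (hprod.mul (isHomogeneous_X_pow (R := R) j₀ (M - ν.sum fun _ k => k))).C_mul (p.coeff ν)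
    have hdeg : (∑ m ∈ ν.support, ν m) + (M - ν.sum fun _ k => k) = M := by
      change (ν.sum fun _ k => k) + (M - ν.sum fun _ k => k) = M
      omega
    rwa [hdeg] at h
  have hFpe : MvPolynomial.eval₂Hom ψ e Fp = MvPolynomial.eval₂ ψ (fun m => e (j m)) p := by
    rw [MvPolynomial.eval₂_eq, hFp, map_sum]
    refine Finset.sum_congr rfl fun ν _ => ?_
    rw [map_mul, map_mul, map_pow, MvPolynomial.eval₂Hom_C, MvPolynomial.eval₂Hom_X', hej, one_pow, mul_one,
      map_prod]
    refine congrArg _ (Finset.prod_congr rfl fun m _ => ?_)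
    rw [map_pow, MvPolynomial.eval₂Hom_X']
  have hFpsymb : (MvPolynomial.eval₂Hom (MvPolynomial.C.comp ((residue A).comp (algebraMap R A)))
          (fun l => linForm fun i => residue A (a l i))) Fp = ∑ ν ∈ p.support,
      C (residue A (algebraMap R A (p.coeff ν))) *
        ((∏ m ∈ ν.support, s m ^ ν m) * s₀ ^ (M - ν.sum fun _ k => k)) := by
    rw [hFp, map_sum]
    refine Finset.sum_congr rfl fun ν _ => ?_
    rw [map_mul, map_mul, map_pow, map_prod, chartSymbolMap_C₅, chartSymbolMap_X₅]
    refine congrArg _ (congrArg₂ _ (Finset.prod_congr rfl fun m _ => ?_) rfl)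
    rw [map_pow, chartSymbolMap_X₅]
  -- a second form for the same element, with symbol in `𝔗`
  obtain ⟨N, F, hF, hFe, hFs⟩ :=
    exists_form_symbolHom_mem_of_mem_chartIdeal 𝔭 A hx a ψ e j₀ hej hF1 hp
  obtain ⟨K, hK⟩ := symbolHom_sub_mem_of_eval₂_eq A hx a ha ψ e j₀ hej hF2 hF3 hFphom hF (hFpe.trans hFe.symm)
  have hmem : s₀ ^ (K + N) *
        (MvPolynomial.eval₂Hom (MvPolynomial.C.comp ((residue A).comp (algebraMap R A)))
          (fun l => linForm fun i => residue A (a l i))) Fp ∈ 𝔗 := by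
    have h1 : s₀ ^ (K + N) *
        (MvPolynomial.eval₂Hom (MvPolynomial.C.comp ((residue A).comp (algebraMap R A)))
          (fun l => linForm fun i => residue A (a l i))) Fp - s₀ ^ (K + M) *
        (MvPolynomial.eval₂Hom (MvPolynomial.C.comp ((residue A).comp (algebraMap R A)))
          (fun l => linForm fun i => residue A (a l i))) F ∈ 𝔗 :=
      tangentConeIdeal_le_span_directrixSpace A hx hK
    have h2 : s₀ ^ (K + M) *
        (MvPolynomial.eval₂Hom (MvPolynomial.C.comp ((residue A).comp (algebraMap R A)))
          (fun l => linForm fun i => residue A (a l i))) F ∈ 𝔗 := 𝔗.mul_mem_left _ hFs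
    have := 𝔗.add_mem h1 h2
    rwa [sub_add_cancel] at this
  -- apply the space map
  obtain ⟨ρ, hρT, hρ1, hρ2⟩ := exists_spaceMap hx a j₀ j hspan hindep
  have hρ := hρT _ hmem
  rw [map_mul, map_pow, hρ1, one_pow, one_mul, hFpsymb, map_sum] at hρ
  have hρ' : ∑ ν ∈ p.support,
      C (residue A (algebraMap R A (p.coeff ν))) * ∏ m ∈ ν.support, (X m : MvPolynomial (Fin q) (ResidueField A)) ^ ν m
        = 0 := by
    rw [← hρ]
    refine Finset.sum_congr rfl fun ν _ => ?_
    rw [map_mul, map_mul, map_pow, map_prod, MvPolynomial.algHom_C, MvPolynomial.algebraMap_eq, hρ1, one_pow,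
      mul_one]
    refine congrArg _ (Finset.prod_congr rfl fun m _ => ?_)
    rw [map_pow, hρ2]
  -- the mapped polynomial vanishes, hence all its coefficients
  have hmap : MvPolynomial.map ((residue A).comp (algebraMap R A)) p = 0 := by
    rw [← hρ']
    conv_lhs => rw [p.as_sum, map_sum]
    refine Finset.sum_congr rfl fun ν _ => ?_
    rw [MvPolynomial.map_monomial, MvPolynomial.monomial_eq, RingHom.comp_apply]
    rfl
  have hcoeff : residue A (algebraMap R A (p.coeff μ)) = 0 := by
    have := congrArg (fun g => MvPolynomial.coeff μ g) hmap
    simpa [MvPolynomial.coeff_map] using this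
  rw [residue_eq_zero_iff] at hcoeff
  exact (IsLocalization.AtPrime.to_map_mem_maximal_iff A 𝔭 (p.coeff μ)).mp hcoeff

include hej hF1 hspan in
/-- **Surjectivity of `k[T_1, …, T_q] → D/𝔑`**: every element of `D` is congruent modulo `𝔑` to
`p(e_{j_1}, …, e_{j_q})` for a polynomial `p ∈ R[T_1, …, T_q]`. Each ratio `e_l` is `≡ ψ(α₀) + Σ_m ψ(α_m) e_{j_m}`, where
`s_l ≡ ᾱ₀ s_{j₀} + Σ_m ᾱ_m s_{j_m} (mod 𝒯)` (the combination `c_l − α₀ c_{j₀} − Σ_m α_m c_{j_m}` has symbol in `𝒯`), and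
every element of `D` is a polynomial in the `e_l` over `ψ(R)`. The `q = 1` case is `exists_polynomial_sub_eval₂_mem_chartIdeal`.
[cite: CossartJannsenSaito2020, Def. 6.34 (i), p. 103 L16] -/
theorem exists_mvPolynomial_sub_eval₂_mem_chartIdeal (d : D) :
    ∃ p : MvPolynomial (Fin q) R, d - MvPolynomial.eval₂ ψ (fun m => e (j m)) p ∈
      (𝔭.map ψ ⊔ Ideal.span {d : D | ∃ lam : Fin r → R,
          (linForm fun i => ∑ l, residue A (algebraMap R A (lam l)) * residue A (a l i)) ∈
            directrixSpace (tangentConeIdeal x hx) ∧ d = ∑ l, ψ (lam l) * e l}) := by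
  classical
  -- coordinates of the symbols `s_l`, lifted to `R`
  have hcoord : ∀ l, ∃ (α₀ : R) (α : Fin q → R), e l - (ψ α₀ + ∑ m, ψ (α m) * e (j m)) ∈
      (𝔭.map ψ ⊔ Ideal.span {d : D | ∃ lam : Fin r → R,
          (linForm fun i => ∑ l, residue A (algebraMap R A (lam l)) * residue A (a l i)) ∈
            directrixSpace (tangentConeIdeal x hx) ∧ d = ∑ l, ψ (lam l) * e l}) := by
    intro l
    have hL : linForm (fun i => residue A (a l i)) ∈ homogeneousSubmodule (Fin n) (ResidueField A) 1 := by
      rw [← range_linForm]; exact LinearMap.mem_range_self _ _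
    obtain ⟨αb₀, αb, hmem⟩ := hspan _ hL
    obtain ⟨α₀, hα₀⟩ := exists_residue_algebraMap_eq₅ 𝔭 A αb₀
    have hαm : ∀ m, ∃ αm : R, residue A (algebraMap R A αm) = αb m :=
      fun m => exists_residue_algebraMap_eq₅ 𝔭 A (αb m)
    choose α hα using hαm
    refine ⟨α₀, α, ?_⟩
    -- the combination `λ = δ_l − α₀ δ_{j₀} − Σ_m α_m δ_{j_m}`
    let lam : Fin r → R := fun l' =>
      (if l' = l then 1 else 0) - (if l' = j₀ then α₀ else 0) - ∑ m, (if l' = j m then α m else 0)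
    have hsymb : (linForm fun i => ∑ l', residue A (algebraMap R A (lam l')) * residue A (a l' i)) =
        linForm (fun i => residue A (a l i)) - αb₀ • linForm (fun i => residue A (a j₀ i)) -
          ∑ m, αb m • linForm (fun i => residue A (a (j m) i)) := by
      have hfun : (fun i => ∑ l', residue A (algebraMap R A (lam l')) * residue A (a l' i)) =
          (fun i => residue A (a l i)) - αb₀ • (fun i => residue A (a j₀ i)) -
            ∑ m, αb m • (fun i => residue A (a (j m) i)) := by
        funext i
        simp only [lam, map_sub, map_sum, Pi.sub_apply, Finset.sum_apply, Pi.smul_apply, smul_eq_mul, sub_mul,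
          Finset.sum_sub_distrib, Finset.sum_mul]
        simp only [apply_ite (algebraMap R A), apply_ite (residue A), map_one, map_zero, ite_mul, one_mul,
          zero_mul, Finset.sum_ite_eq', Finset.mem_univ, if_true, hα₀, hα]
        rw [Finset.sum_comm]
        simp only [Finset.sum_ite_eq', Finset.mem_univ, if_true]
      rw [hfun, map_sub, map_sub, map_smul, map_sum]
      simp_rw [map_smul]
    have hval : ∑ l', ψ (lam l') * e l' = e l - (ψ α₀ + ∑ m, ψ (α m) * e (j m)) := by
      simp only [lam, map_sub, map_sum, sub_mul, Finset.sum_sub_distrib, Finset.sum_mul]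
      simp only [apply_ite ψ, map_one, map_zero, ite_mul, one_mul, zero_mul, Finset.sum_ite_eq',
        Finset.mem_univ, if_true, hej, mul_one]
      rw [Finset.sum_comm]
      simp only [Finset.sum_ite_eq', Finset.mem_univ, if_true]
      ring
    rw [← hval]
    exact sum_mul_mem_chartIdeal 𝔭 A hx a ψ e lam (hsymb ▸ hmem)
  choose α₀ α hα using hcoord
  -- `d = F(e)`
  obtain ⟨m, F, -, rfl⟩ := hF1 d
  refine ⟨MvPolynomial.aeval (fun l => (C (α₀ l) + ∑ m, C (α l m) * X m : MvPolynomial (Fin q) R)) F, ?_⟩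
  -- evaluate: `eval₂ ψ (e ∘ j) (F(α₀ + Σ α_m T_m)) = F(ψ α₀ + Σ ψ α_m e_{j m})`
  have heval : MvPolynomial.eval₂ ψ (fun m => e (j m))
      (MvPolynomial.aeval (fun l => (C (α₀ l) + ∑ m, C (α l m) * X m : MvPolynomial (Fin q) R)) F) =
      MvPolynomial.eval₂Hom ψ (fun l => ψ (α₀ l) + ∑ m, ψ (α l m) * e (j m)) F := by
    have hhom : (MvPolynomial.eval₂Hom ψ (fun m => e (j m))).comp
        (MvPolynomial.aeval (fun l => (C (α₀ l) + ∑ m, C (α l m) * X m : MvPolynomial (Fin q) R)) :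
          MvPolynomial (Fin r) R →ₐ[R] MvPolynomial (Fin q) R).toRingHom =
        MvPolynomial.eval₂Hom ψ (fun l => ψ (α₀ l) + ∑ m, ψ (α l m) * e (j m)) := by
      refine MvPolynomial.ringHom_ext (fun ρ => ?_) (fun l => ?_)
      · simp
      · simp only [AlgHom.toRingHom_eq_coe, RingHom.coe_comp, RingHom.coe_coe, Function.comp_apply,
          MvPolynomial.aeval_X, MvPolynomial.coe_eval₂Hom, MvPolynomial.eval₂_add, MvPolynomial.eval₂_C,
          MvPolynomial.eval₂_sum, MvPolynomial.eval₂_mul, MvPolynomial.eval₂_X]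
    exact RingHom.congr_fun hhom F
  rw [heval]
  -- `F(e) − F(e') ∈ (e_l − e'_l) ⊆ 𝔑`
  have hcong : ∀ G : MvPolynomial (Fin r) R, MvPolynomial.eval₂Hom ψ e G -
      MvPolynomial.eval₂Hom ψ (fun l => ψ (α₀ l) + ∑ m, ψ (α l m) * e (j m)) G ∈
        (𝔭.map ψ ⊔ Ideal.span {d : D | ∃ lam : Fin r → R,
          (linForm fun i => ∑ l, residue A (algebraMap R A (lam l)) * residue A (a l i)) ∈
            directrixSpace (tangentConeIdeal x hx) ∧ d = ∑ l, ψ (lam l) * e l}) := by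
    intro G
    induction G using MvPolynomial.induction_on with
    | C ρ =>
      rw [MvPolynomial.eval₂Hom_C, MvPolynomial.eval₂Hom_C, sub_self]
      exact Ideal.zero_mem _
    | add p' q' hp hq =>
      have : MvPolynomial.eval₂Hom ψ e (p' + q') -
            MvPolynomial.eval₂Hom ψ (fun l => ψ (α₀ l) + ∑ m, ψ (α l m) * e (j m)) (p' + q') =
          (MvPolynomial.eval₂Hom ψ e p' - MvPolynomial.eval₂Hom ψ (fun l => ψ (α₀ l) + ∑ m, ψ (α l m) * e (j m)) p') +
            (MvPolynomial.eval₂Hom ψ e q' -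
              MvPolynomial.eval₂Hom ψ (fun l => ψ (α₀ l) + ∑ m, ψ (α l m) * e (j m)) q') := by
        rw [map_add, map_add]; ring
      rw [this]
      exact Ideal.add_mem _ hp hq
    | mul_X p' l hp =>
      have : MvPolynomial.eval₂Hom ψ e (p' * X l) -
            MvPolynomial.eval₂Hom ψ (fun l => ψ (α₀ l) + ∑ m, ψ (α l m) * e (j m)) (p' * X l) =
          (MvPolynomial.eval₂Hom ψ e p' -
              MvPolynomial.eval₂Hom ψ (fun l => ψ (α₀ l) + ∑ m, ψ (α l m) * e (j m)) p') * e l +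
            MvPolynomial.eval₂Hom ψ (fun l => ψ (α₀ l) + ∑ m, ψ (α l m) * e (j m)) p' *
              (e l - (ψ (α₀ l) + ∑ m, ψ (α l m) * e (j m))) := by
        rw [map_mul, map_mul, MvPolynomial.eval₂Hom_X', MvPolynomial.eval₂Hom_X']; ring
      rw [this]
      exact Ideal.add_mem _ (Ideal.mul_mem_right _ _ hp) (Ideal.mul_mem_left _ _ (hα l))
  exact hcong F

include hx ha hej hF1 hF2 hF3 hspan hindep in
/-- **`D/𝔑 ≅ k[T_1, …, T_q]`: the ring of `ℙ(Dir(A))` on the chart `c_{j₀} ≠ 0` is the polynomial ring in the `q = t − 1`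
ratios `T_m = c_{j_m}/c_{j₀}` over the residue field `k = R/𝔭`** — the standard affine piece `𝔸^{t−1}_{k(x)}` of
`C_1 = ℙ(Dir_x(X)) ≅ ℙ^{t−1}_{k(x)}` (CJS p. 103 L16, Def. 6.34 (i)). The isomorphism sends `r̄ ↦ ψ(r)` and `T_m ↦ e_{j_m}`
(`coeff_mem_of_eval₂_comp_mem_chartIdeal` for injectivity, `exists_mvPolynomial_sub_eval₂_mem_chartIdeal` for surjectivity,
Mathlib `MvPolynomial.quotientEquivQuotientMvPolynomial`). The `q = 1` case is
`exists_ringEquiv_polynomial_quotient_chartIdeal`. [cite: CossartJannsenSaito2020, Def. 6.34 (i), p. 103 L16] -/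
theorem exists_ringEquiv_mvPolynomial_quotient_chartIdeal :
    ∃ Ξ : MvPolynomial (Fin q) (R ⧸ 𝔭) ≃+* D ⧸ (𝔭.map ψ ⊔ Ideal.span {d : D | ∃ lam : Fin r → R,
          (linForm fun i => ∑ l, residue A (algebraMap R A (lam l)) * residue A (a l i)) ∈
            directrixSpace (tangentConeIdeal x hx) ∧ d = ∑ l, ψ (lam l) * e l}),
      (∀ ρ : R, Ξ (C (Ideal.Quotient.mk 𝔭 ρ)) = Ideal.Quotient.mk _ (ψ ρ)) ∧
        ∀ m, Ξ (X m) = Ideal.Quotient.mk _ (e (j m)) := by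
  set 𝔑 := (𝔭.map ψ ⊔ Ideal.span {d : D | ∃ lam : Fin r → R,
          (linForm fun i => ∑ l, residue A (algebraMap R A (lam l)) * residue A (a l i)) ∈
            directrixSpace (tangentConeIdeal x hx) ∧ d = ∑ l, ψ (lam l) * e l}) with h𝔑
  -- `Θ : R[T] → D/𝔑`
  let Θ : MvPolynomial (Fin q) R →+* D ⧸ 𝔑 :=
    MvPolynomial.eval₂Hom ((Ideal.Quotient.mk 𝔑).comp ψ) fun m => Ideal.Quotient.mk 𝔑 (e (j m))
  have hΘ : ∀ p : MvPolynomial (Fin q) R, Θ p = Ideal.Quotient.mk 𝔑 (MvPolynomial.eval₂ ψ (fun m => e (j m)) p) := by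
    intro p
    have hcomp : Θ = (Ideal.Quotient.mk 𝔑).comp (MvPolynomial.eval₂Hom ψ fun m => e (j m)) := by
      rw [MvPolynomial.comp_eval₂Hom]
    rw [hcomp]
    rfl
  have hΘsurj : Function.Surjective Θ := by
    intro q'
    obtain ⟨d, rfl⟩ := Ideal.Quotient.mk_surjective q'
    obtain ⟨p, hp⟩ := exists_mvPolynomial_sub_eval₂_mem_chartIdeal 𝔭 A hx a ψ e j₀ j hej hF1 hspan d
    refine ⟨p, ?_⟩
    rw [hΘ, Ideal.Quotient.eq]
    have := Submodule.neg_mem _ hp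
    rwa [neg_sub] at this
  have hker : RingHom.ker Θ = 𝔭.map (C : R →+* MvPolynomial (Fin q) R) := by
    ext p
    rw [RingHom.mem_ker, hΘ, Ideal.Quotient.eq_zero_iff_mem, MvPolynomial.mem_map_C_iff]
    constructor
    · intro hp μ
      exact coeff_mem_of_eval₂_comp_mem_chartIdeal 𝔭 A hx a ha ψ e j₀ j hej hF1 hF2 hF3 hspan hindep hp μ
    · intro hp
      rw [MvPolynomial.eval₂_eq]
      refine Ideal.sum_mem _ fun ν _ => Ideal.mul_mem_right _ _ ?_
      exact map_le_chartIdeal 𝔭 A hx a ψ e (Ideal.mem_map_of_mem ψ (hp ν))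
  -- assemble
  let Ξ₁ : MvPolynomial (Fin q) (R ⧸ 𝔭) ≃+* MvPolynomial (Fin q) R ⧸ (𝔭.map (C : R →+* MvPolynomial (Fin q) R)) :=
    (MvPolynomial.quotientEquivQuotientMvPolynomial 𝔭).toRingEquiv
  let Ξ₂ : MvPolynomial (Fin q) R ⧸ (𝔭.map (C : R →+* MvPolynomial (Fin q) R)) ≃+*
      MvPolynomial (Fin q) R ⧸ RingHom.ker Θ :=
    Ideal.quotEquivOfEq hker.symm
  let Ξ₃ : MvPolynomial (Fin q) R ⧸ RingHom.ker Θ ≃+* D ⧸ 𝔑 := RingHom.quotientKerEquivOfSurjective hΘsurj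
  refine ⟨Ξ₁.trans (Ξ₂.trans Ξ₃), fun ρ => ?_, fun m => ?_⟩
  · have h1 : Ξ₁ (C (Ideal.Quotient.mk 𝔭 ρ)) = Ideal.Quotient.mk _ (C ρ) := by
      simp [Ξ₁, MvPolynomial.quotientEquivQuotientMvPolynomial]
    rw [RingEquiv.trans_apply, RingEquiv.trans_apply, h1]
    change Ξ₃ (Ideal.Quotient.mk _ (C ρ)) = _
    rw [RingHom.quotientKerEquivOfSurjective_apply_mk, hΘ, MvPolynomial.eval₂_C]
  · have h1 : Ξ₁ (X m) = Ideal.Quotient.mk _ (X m) := by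
      simp [Ξ₁, MvPolynomial.quotientEquivQuotientMvPolynomial]
    rw [RingEquiv.trans_apply, RingEquiv.trans_apply, h1]
    change Ξ₃ (Ideal.Quotient.mk _ (X m)) = _
    rw [RingHom.quotientKerEquivOfSurjective_apply_mk, hΘ, MvPolynomial.eval₂_X]

end Chart

end Literature.RingTheory.HilbertSamuel

end
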